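import Summits.Ventures.PercRepro.C026InteriorFlip
import Summits.Ventures.PercRepro.C026PFunTwoLiveAdjacent

/-!
# One-dimensional cluster cubes (mine-3 §42 (e) (3); p6, gen 18)

Let `U` be a configuration in which the blue cluster of the terminal `b` is the singleton `{b}` and
`c` reaches the other terminal `a` in red avoiding `b` (`U ∈ Good₂`).  Closing one red edge `e` at `a`
(not at `b`) gives the configuration `U − e` below `U`; mine-3's LEMMA (one-dimensional cubes) says
that AT MOST ONE such edge makes `U − e` a `Bad₂` source: a red walk from `c` to `a` avoiding `b`, cut
at its first arrival at `a`, uses an edge at `a` only in its last step, so for two distinct edges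
`e₀ ≠ e₁` at `a` it survives in `U − e₀` or in `U − e₁` (`good_update_false_or`).  Hence the hub
pattern «two Bad sources, one per terminal, under one clean source» is the worst case for
one-dimensional cubes, and the capacity `4` of a clean `GG` source is exactly enough for them.
-/

namespace PercRepro

namespace MultiGraph

open Finset

variable {V E : Type*} {G : MultiGraph V E}

/-- Closing an edge that is not incident to `b` leaves a singleton blue cluster `{b}` a singleton. -/
theorem cluster_compl_update_false_of_not_incident [DecidableEq E] {T : Config E} {b : V} {e : E}
    (hb : G.cluster Tᶜ b = {b}) (he : G.fst e ≠ b ∧ G.snd e ≠ b) :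
    G.cluster (Function.update T e false)ᶜ b = {b} := by
  rw [compl_update_false]
  ext v
  simp only [mem_cluster, Set.mem_singleton_iff]
  constructor
  · intro h
    refine Conn.induction (G := G) (ω := Function.update Tᶜ e true) (u := b)
      (motive := fun w => w = b) rfl ?_ h
    intro p q _ hpq hp
    subst hp
    obtain ⟨e', he', hend⟩ := hpq
    by_cases hee : e' = e
    · subst hee
      exfalso
      rcases hend with ⟨h1, _⟩ | ⟨_, h2⟩
      · exact he.1 h1
      · exact he.2 h2
    · rw [Function.update_of_ne hee] at he'
      have hq : q ∈ G.cluster Tᶜ p := (G.mem_cluster).2 (Conn.of_openAdj ⟨e', he', hend⟩)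
      rw [hb] at hq
      exact (Set.mem_singleton_iff.1 hq).symm ▸ rfl
  · rintro rfl
    exact Conn.refl G _ _

/-- A walk avoiding `b` that reaches `a` for the first time at its end survives the closing of any
edge `e` at `a` that its last step does not use: every earlier step has both endpoints off `a`. -/
theorem walkAvoiding_update_false_of_last_step [DecidableEq E] {T : Config E} {a b c x : V} {e : E}
    (hea : G.fst e = a ∨ G.snd e = a)
    (hwalk : Relation.ReflTransGen
      (fun p q => (G.OpenAdj T p q ∧ q ∉ ({b} : Set V)) ∧ p ∉ ({a} : Set V)) c x)
    (hx : x ∉ ({a} : Set V)) (hc : c ∉ ({b} : Set V)) (hab : a ∉ ({b} : Set V))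
    (hlast : G.OpenAdj (Function.update T e false) x a) :
    G.WalkAvoiding (Function.update T e false) {b} c a := by
  refine ⟨hc, Relation.ReflTransGen.tail ?_ ⟨hlast, hab⟩⟩
  clear hc
  induction hwalk using Relation.ReflTransGen.head_induction_on with
  | refl => exact Relation.ReflTransGen.refl
  | @head u p hup hpx ih =>
    have hp : p ∉ ({a} : Set V) := by
      rcases Relation.ReflTransGen.cases_head hpx with rfl | ⟨y, hpy, _⟩
      · exact hx
      · exact hpy.2
    refine Relation.ReflTransGen.head ⟨?_, hup.1.2⟩ ih
    -- the step's edge has both endpoints off `a`, so it is not `e`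
    obtain ⟨e', he', hend⟩ := hup.1.1
    refine ⟨e', ?_, hend⟩
    have hne : e' ≠ e := by
      rintro rfl
      rcases hend with ⟨h1, h2⟩ | ⟨h1, h2⟩ <;> rcases hea with h3 | h3
      · exact hup.2 (Set.mem_singleton_iff.2 (h1.symm.trans h3))
      · exact hp (Set.mem_singleton_iff.2 (h2.symm.trans h3))
      · exact hp (Set.mem_singleton_iff.2 (h1.symm.trans h3))
      · exact hup.2 (Set.mem_singleton_iff.2 (h2.symm.trans h3))
    rw [Function.update_of_ne hne]
    exact he'

/-- **LEMMA (one-dimensional cubes)** (mine-3 §42 (e) (3)).  Let the blue cluster of `b` be `{b}`,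
let `c` reach `a ≠ b` in `T` avoiding `b`, and let `e₀ ≠ e₁` be two edges at `a` not incident to `b`.
Then `c` still reaches `a` avoiding the (unchanged) blue cluster of `b` after closing `e₀`, or after
closing `e₁`: at most one edge at `a` turns the source `T` into a `Bad₂` source. -/
theorem good_update_false_or [DecidableEq E] {T : Config E} {a b c : V} (hab : a ≠ b)
    (hb : G.cluster Tᶜ b = {b}) (h : G.WalkAvoiding T (G.cluster Tᶜ b) c a) {e₀ e₁ : E}
    (hne : e₀ ≠ e₁) (ha₀ : G.fst e₀ = a ∨ G.snd e₀ = a) (ha₁ : G.fst e₁ = a ∨ G.snd e₁ = a)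
    (hb₀ : G.fst e₀ ≠ b ∧ G.snd e₀ ≠ b) (hb₁ : G.fst e₁ ≠ b ∧ G.snd e₁ ≠ b) :
    G.WalkAvoiding (Function.update T e₀ false) (G.cluster (Function.update T e₀ false)ᶜ b) c a ∨
      G.WalkAvoiding (Function.update T e₁ false) (G.cluster (Function.update T e₁ false)ᶜ b) c a := by
  rw [cluster_compl_update_false_of_not_incident hb hb₀, cluster_compl_update_false_of_not_incident hb hb₁]
  rw [hb] at h
  obtain ⟨hc, hwalk⟩ := h
  have hab' : a ∉ ({b} : Set V) := by simpa using hab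
  -- cut the walk at its first arrival at `a`
  obtain ⟨w, hw, hwalk'⟩ := exists_first_mem_of_reflTransGen (Y := ({a} : Set V)) hwalk (by simp)
  rw [Set.mem_singleton_iff] at hw
  subst hw
  rcases Relation.ReflTransGen.cases_tail hwalk' with rfl | ⟨x, hcx, hxw⟩
  · exact Or.inl ⟨hc, Relation.ReflTransGen.refl⟩
  · -- the last step `x → a` uses some open edge `e*`; it is not both `e₀` and `e₁`
    obtain ⟨e', he', hend⟩ := hxw.1.1
    by_cases h0 : e' = e₀
    · right
      refine walkAvoiding_update_false_of_last_step ha₁ hcx hxw.2 hc hab' ⟨e', ?_, hend⟩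
      rw [Function.update_of_ne (h0 ▸ hne)]
      exact he'
    · left
      refine walkAvoiding_update_false_of_last_step ha₀ hcx hxw.2 hc hab' ⟨e', ?_, hend⟩
      rw [Function.update_of_ne h0]
      exact he'

end MultiGraph

end PercRepro
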